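import Summits.QuantumAdvantage.QuantumAdvantage.Theorems.CubicForrelationNearExactIsExactSixteenLevelEight

/-!
# Crux `CubicForrelation.NearExactIsExact` (stmt-QuantumAdvantage-14043) — n = 16: STRUCTURE of a hypothetical boundary pair `Φ = 31/32`

Certificate seat `b2b-cforr-cert` (gen 4).  HONEST FRAMING: a partial, kernel-checked verdict about the finite slice `n = 16` of the crux —
NOT summit progress, and NOT the full statement `Φ ≥ 31/32 ⇒ Φ = 1` on 16 bits (open: the level-7 configuration "odd quotient on a 14-flat"
and the split type-O configurations, see the gen-4 write-up `PROOF-N14-BOUNDARY.md` §n = 16 in the cell's HOME).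

The tree has `θ₁₆ ∈ [15/16, 31/32]` (`theta_sixteen_bounds_31_32`).  Whether the one-sided tower constant `31/32` is ATTAINED on 16 bits is
a two-sided question.  `sb_sixteen_boundary_structure`: if cubic `f, g : 𝔽₂¹⁶ → 𝔽₂` have `31/32 ≤ Φ(f,g) < 1`, then, writing
`W_g = 64·u_g`, `W_f = 64·u_f` (Ax), NEITHER spectrum is of type O (some `u` is even: `st_typeO_sixteen_lt`) and NEITHER is at level
`≥ 8` (some `u` is not divisible by `4`: `se_levelEight_ge`) — on both sides the 2-adic type is mixed at levels 6–7.

References: as in the imported files.  Everything below is proved from the tree; axioms are the standard three.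
-/

set_option linter.dupNamespace false -- D-0017: single-problem summit ⇒ `QuantumAdvantage.QuantumAdvantage` by design

noncomputable section

namespace Summit.QuantumAdvantage.QuantumAdvantage.Theorems.CubicForrelation.NearExactIsExact

open Finset
open Literature.Computability.QuantumComplexity
open Literature.Computability.QuantumComplexity.DerivativeWalsh (W)
open Summit.QuantumAdvantage.QuantumAdvantage.Theorems.SignedCubicForrelationNotPrBPP.Negative.HalfQuad (forrelation_comm)

/-- One side: for cubic `f, g` on 16 bits with `31/32 ≤ Φ(f,g) ≠ 1` and `W_g = 64·u`, some `u(x)` is even (not type O) and some `u(x)` is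
not divisible by `4` (not level `≥ 8`). [this work] -/
theorem sb_sixteen_boundary_side (f g : (Fin (8 + 8) → Bool) → Bool) (hf : IsDegLeFun 3 f) (hg : IsDegLeFun 3 g)
    (hΦ : (31 / 32 : ℝ) ≤ forrelation f g) (hne : forrelation f g ≠ 1)
    (u : (Fin (8 + 8) → Bool) → ℤ) (hu : ∀ x, W (fun y => signOf (g y)) x = (2 : ℝ) ^ 6 * (u x : ℝ)) :
    (∃ x, ¬ Odd (u x)) ∧ (∃ x, ¬ (4 : ℤ) ∣ u x) := by
  refine ⟨?_, ?_⟩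
  · by_contra h
    push Not at h
    exact absurd hΦ (not_le.2 (st_typeO_sixteen_lt f g hf hg u hu h))
  · by_contra h
    push Not at h
    have hw : ∀ x, W (fun y => signOf (g y)) x = (2 : ℝ) ^ 8 * (((u x / 4 : ℤ)) : ℝ) := by
      intro x
      rw [hu x]
      obtain ⟨k, hk⟩ := h x
      rw [hk, Int.mul_ediv_cancel_left k (by norm_num : (4 : ℤ) ≠ 0)]
      push_cast
      ring
    exact hne (se_levelEight_ge f g hf hg _ hw hΦ)

/-- **Structure of a hypothetical boundary pair on 16 bits.** If cubic `f, g : 𝔽₂¹⁶ → 𝔽₂` satisfy `31/32 ≤ Φ(f,g) < 1`, then with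
`W_g = 64·u_g` and `W_f = 64·u_f` (Ax): on BOTH sides some quotient is even and some quotient is not divisible by `4` — both spectra are of
mixed 2-adic type at levels 6–7 (type O and level `≥ 8` are excluded two-sidedly).  Partial finite-slice verdict; NOT summit progress.
[this work] -/
theorem sb_sixteen_boundary_structure (f g : (Fin (8 + 8) → Bool) → Bool) (hf : IsDegLeFun 3 f) (hg : IsDegLeFun 3 g)
    (hΦ : (31 / 32 : ℝ) ≤ forrelation f g) (hlt : forrelation f g < 1)
    (ug : (Fin (8 + 8) → Bool) → ℤ) (hug : ∀ x, W (fun y => signOf (g y)) x = (2 : ℝ) ^ 6 * (ug x : ℝ))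
    (uf : (Fin (8 + 8) → Bool) → ℤ) (huf : ∀ x, W (fun y => signOf (f y)) x = (2 : ℝ) ^ 6 * (uf x : ℝ)) :
    ((∃ x, ¬ Odd (ug x)) ∧ (∃ x, ¬ (4 : ℤ) ∣ ug x)) ∧ ((∃ x, ¬ Odd (uf x)) ∧ (∃ x, ¬ (4 : ℤ) ∣ uf x)) := by
  have hΦ' : (31 / 32 : ℝ) ≤ forrelation g f := by rw [forrelation_comm]; exact hΦ
  have hne : forrelation f g ≠ 1 := ne_of_lt hlt
  have hne' : forrelation g f ≠ 1 := by rw [forrelation_comm]; exact hne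
  exact ⟨sb_sixteen_boundary_side f g hf hg hΦ hne ug hug, sb_sixteen_boundary_side g f hg hf hΦ' hne' uf huf⟩

end Summit.QuantumAdvantage.QuantumAdvantage.Theorems.CubicForrelation.NearExactIsExact

end
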